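import Mathlib
import HarnessLib
import Literature.Computability.AlgebraicComplexity.SyntacticMultilinear
import Literature.Barriers.ValiantsHypothesis.FullRankMultilinearBaurStrassen

/-!
# Syntactically multilinear circuits compute multilinear polynomials

Helper file (`--supports stmt-ValiantsHypothesis-17621`) for the support item
`Summit.ValiantsHypothesis.ValiantsHypothesis.Theses.MonotoneRestoration.MultilinearRestorationQP`
(restoration at quasi-polynomial cost for matrix-symmetric families over `ℝ≥0` of polynomial
SYNTACTICALLY MULTILINEAR monotone circuit size, tree `smCircuitSize` over `NNReal`), route
`MonotoneRestoration`.  It does not import the route file: it records, on the tree's list model of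
circuits (`Literature.Computability.AlgebraicComplexity.ArithCircuit`, syntactic variable sets
`gateVarSets`, Raz–Yehudayoff 2008 §2), the two facts behind the sentence "the rung is a special
case of the crux `MonotoneRestorationQP`" (used in
`Theorems/MonotoneRestorationMultilinearRestorationQPOfCrux.lean`):

* `sm_getD_gateValues` — in a syntactically multilinear circuit the value of every gate lies in
  `k[X_v]` (`X_v` its syntactic variable set) and is MULTILINEAR (`degreeOf x ≤ 1` for every
  variable `x`): product gates multiply polynomials with pairwise disjoint variable sets;
  `degreeOf_eval_le_one`, `totalDegree_le_card_of_degreeOf_le_one` — hence the output is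
  multilinear and has total degree `≤ |σ|`;
* `exists_circuit_of_smCircuitSize_le`, `complexity_le_of_smCircuitSize_le`,
  `totalDegree_le_of_smCircuitSize_le` — a finite bound `smCircuitSize f ≤ s` is witnessed by a
  fan-in-two syntactically multilinear circuit of size `≤ s`, so `complexity f ≤ s` and
  `totalDegree f ≤ |σ|`.

Bookkeeping (`gateVarSets_append_singleton`, `length_gateVarSets`, `mem_gateVarSet_iff`,
`isSyntacticallyMultilinear_iff_algebraicComplexity`) is REUSED from the Raz–Yehudayoff /
Alon–Kumar–Volk development `Literature/Barriers/ValiantsHypothesis/FullRankMultilinear*.lean`, whose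
lemmas are stated for that file's verbatim copies `Literature.Barriers.ValiantsHypothesis.gateVarSets`
etc. of the tree definitions; the internal lemmas below therefore live on those copies and the two
public corollaries convert at the boundary (`isSyntacticallyMultilinear_iff_algebraicComplexity`).
No named fact of the barrier catalogue is used; nothing is vendored.

Sources: RazYehudayoff2008 §2 (the model), Burgisser2000 Def. 2.1 (complexity).
-/

-- single-problem summit: `Summit.ValiantsHypothesis.ValiantsHypothesis.…` is the namespace by design (D-0017)
set_option linter.dupNamespace false

noncomputable section

namespace Summit.ValiantsHypothesis.ValiantsHypothesis.Theorems

open MvPolynomial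
open Literature.Computability.AlgebraicComplexity (ArithCircuit complexity)
open Literature.Computability.AlgebraicComplexity.ArithCircuit
open Literature.Barriers.ValiantsHypothesis (operandVarSet gateVarSet gateVarSets
  isSyntacticallyMultilinear_iff_algebraicComplexity)
open Literature.Barriers.ValiantsHypothesis.RazYehudayoff (gateVarSets_append_singleton
  length_gateVarSets)
open Literature.Barriers.ValiantsHypothesis.AKV (mem_gateVarSet_iff)

namespace MultilinearRung

universe u v

variable {k : Type u} {σ : Type v}

/-! ### Multilinearity of gate values -/

section Values

variable [CommSemiring k]

/-- A polynomial supported away from `x` has `x`-degree `0`. [folklore] -/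
theorem degreeOf_eq_zero_of_mem_supported {s : Set σ} {p : MvPolynomial σ k}
    (hp : p ∈ supported k s) {x : σ} (hx : x ∉ s) : p.degreeOf x = 0 := by
  by_contra h
  exact hx (mem_supported.1 hp (Finset.mem_coe.2 (mem_vars_iff_degreeOf_ne_zero.2 h)))

/-- The variable `X i` is multilinear (no nontriviality of `k` needed). [folklore] -/
theorem degreeOf_X_le_one (x i : σ) : (X i : MvPolynomial σ k).degreeOf x ≤ 1 := by
  rw [degreeOf_le_iff]
  intro m hm
  have hm' : m = Finsupp.single i 1 := by
    have := support_monomial_subset (s := Finsupp.single i 1) (a := (1 : k)) hm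
    simpa using this
  subst hm'
  classical
  rw [Finsupp.single_apply]
  split_ifs <;> omega

/-- Sums of multilinear polynomials are multilinear. [folklore] -/
theorem degreeOf_list_sum_le_one (x : σ) (l : List (MvPolynomial σ k))
    (h : ∀ p ∈ l, p.degreeOf x ≤ 1) : l.sum.degreeOf x ≤ 1 := by
  induction l with
  | nil => simp [degreeOf_zero]
  | cons p l ih =>
    rw [List.sum_cons]
    refine (degreeOf_add_le x p l.sum).trans (max_le (h p (by simp)) (ih fun q hq => h q (by simp [hq])))

variable [DecidableEq σ]

omit [DecidableEq σ] in
/-- A product of operand values none of whose syntactic variable sets contains `x` has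
`x`-degree `0`. [cite: RazYehudayoff2008, §2] -/
theorem degreeOf_prod_eq_zero (vals : List (MvPolynomial σ k)) (vs : List (Finset σ))
    (hop : ∀ u : Operand k σ, u.eval vals ∈ supported k (↑(operandVarSet vs u) : Set σ))
    (x : σ) (us : List (Operand k σ)) (hx : ∀ u ∈ us, x ∉ operandVarSet vs u) :
    ((us.map fun u : Operand k σ => u.eval vals).prod).degreeOf x = 0 := by
  induction us with
  | nil => simp
  | cons u us ih =>
    rw [List.map_cons, List.prod_cons]
    have h1 : (u.eval vals).degreeOf x = 0 :=
      degreeOf_eq_zero_of_mem_supported (hop u) (by exact_mod_cast hx u (by simp))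
    have h2 := ih fun v hv => hx v (by simp [hv])
    have := degreeOf_mul_le x (u.eval vals) ((us.map fun u : Operand k σ => u.eval vals).prod)
    rw [h1, h2] at this
    exact Nat.eq_zero_of_le_zero this

/-- **Product gates of a syntactically multilinear circuit are multilinear**: a product of
multilinear operand values with pairwise disjoint syntactic variable sets is multilinear.
[cite: RazYehudayoff2008, §2] -/
theorem degreeOf_prod_le_one (vals : List (MvPolynomial σ k)) (vs : List (Finset σ))
    (hop : ∀ u : Operand k σ, u.eval vals ∈ supported k (↑(operandVarSet vs u) : Set σ) ∧
      ∀ x, (u.eval vals).degreeOf x ≤ 1)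
    (x : σ) (us : List (Operand k σ)) (hpw : (us.map (operandVarSet vs)).Pairwise Disjoint) :
    ((us.map fun u : Operand k σ => u.eval vals).prod).degreeOf x ≤ 1 := by
  induction us with
  | nil => simp
  | cons u us ih =>
    rw [List.map_cons, List.prod_cons]
    rw [List.map_cons, List.pairwise_cons] at hpw
    refine (degreeOf_mul_le x _ _).trans ?_
    by_cases hxu : x ∈ operandVarSet vs u
    · -- `x` occurs syntactically in `u`, hence in no other operand
      have hrest : ((us.map fun u : Operand k σ => u.eval vals).prod).degreeOf x = 0 := by
        refine degreeOf_prod_eq_zero vals vs (fun u => (hop u).1) x us fun v hv hxv => ?_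
        have hd : Disjoint (operandVarSet vs u) (operandVarSet vs v) :=
          hpw.1 _ (List.mem_map.2 ⟨v, hv, rfl⟩)
        exact Finset.disjoint_left.1 hd hxu hxv
      rw [hrest, add_zero]
      exact (hop u).2 x
    · have hu0 : (u.eval vals).degreeOf x = 0 :=
        degreeOf_eq_zero_of_mem_supported (hop u).1 (by exact_mod_cast hxu)
      rw [hu0, zero_add]
      exact ih hpw.2

/-- **Gate values of a syntactically multilinear circuit live in `k[X_v]` and are multilinear.**
For a gate list whose product gates have operands with pairwise disjoint syntactic variable sets
(the condition `IsSyntacticallyMultilinear`, stated on the list), the value of gate `j` lies in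
`supported k X_j` and has degree `≤ 1` in every variable; junk indices carry the value `0`.
[cite: RazYehudayoff2008, §2] -/
theorem sm_getD_gateValues (gs : List (Gate k σ))
    (hsm : ∀ (i : ℕ) (args : List (Operand k σ)), gs[i]? = some (.prod args) →
      (args.map (operandVarSet (gateVarSets (gs.take i)))).Pairwise Disjoint) (j : ℕ) :
    (gateValues gs).getD j 0 ∈ supported k (↑((gateVarSets gs).getD j ∅) : Set σ) ∧
      ∀ x, ((gateValues gs).getD j 0).degreeOf x ≤ 1 := by
  induction gs using List.reverseRecOn generalizing j with
  | nil =>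
    simp only [gateValues, gateVarSets, List.foldl_nil, List.getD_nil]
    exact ⟨Subalgebra.zero_mem _, fun x => by simp [degreeOf_zero]⟩
  | append_singleton gs g ih =>
    -- the hypothesis restricts to the prefix `gs`
    have hsm' : ∀ (i : ℕ) (args : List (Operand k σ)), gs[i]? = some (.prod args) →
        (args.map (operandVarSet (gateVarSets (gs.take i)))).Pairwise Disjoint := by
      intro i args hi
      have hi' : i < gs.length := (List.getElem?_eq_some_iff.1 hi).1
      have h := hsm i args (by rw [List.getElem?_append_left hi']; exact hi)
      rwa [List.take_append_of_le_length hi'.le] at h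
    have ih' := ih hsm'
    -- operand-level facts against the values / variable sets of `gs`
    have hop : ∀ u : Operand k σ,
        u.eval (gateValues gs) ∈ supported k (↑(operandVarSet (gateVarSets gs) u) : Set σ) ∧
        ∀ x, (u.eval (gateValues gs)).degreeOf x ≤ 1 := by
      intro u
      cases u with
      | var i =>
        refine ⟨?_, fun x => degreeOf_X_le_one x i⟩
        simp only [Operand.eval, operandVarSet, Finset.coe_singleton]
        exact Algebra.subset_adjoin (Set.mem_image_of_mem _ (Set.mem_singleton i))
      | const c =>
        refine ⟨?_, fun x => by simp [Operand.eval, degreeOf_C]⟩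
        simp only [Operand.eval, operandVarSet]
        exact Subalgebra.algebraMap_mem _ c
      | gate j' => exact ih' j'
    have hlv : (gateValues gs).length = gs.length := gateValues_length gs
    have hls : (gateVarSets gs).length = gs.length := length_gateVarSets gs
    rw [gateValues_append_singleton, gateVarSets_append_singleton]
    rcases lt_trichotomy j gs.length with hj | hj | hj
    · -- an old gate
      rw [List.getD_append (gateValues gs) _ 0 j (by rw [hlv]; exact hj),
        List.getD_append (gateVarSets gs) _ ∅ j (by rw [hls]; exact hj)]
      exact ih' j
    · -- the new gate `g`
      subst hj
      have h1 : (gateValues gs ++ [g.eval (gateValues gs)]).getD gs.length 0 =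
          g.eval (gateValues gs) := by
        rw [List.getD_append_right (gateValues gs) _ 0 gs.length hlv.le, hlv, Nat.sub_self]
        rfl
      have h2 : (gateVarSets gs ++ [gateVarSet (gateVarSets gs) g]).getD gs.length ∅ =
          gateVarSet (gateVarSets gs) g := by
        rw [List.getD_append_right (gateVarSets gs) _ ∅ gs.length hls.le, hls, Nat.sub_self]
        rfl
      rw [h1, h2]
      have hop' : ∀ u ∈ g.args, u.eval (gateValues gs) ∈
          supported k (↑(gateVarSet (gateVarSets gs) g) : Set σ) := fun u hu =>
        supported_mono (Finset.coe_subset.2 fun x hx =>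
          (mem_gateVarSet_iff (gateVarSets gs) g x).2 ⟨u, hu, hx⟩) (hop u).1
      -- the syntactic-multilinearity condition at the new gate
      have hpw : ∀ args, g = .prod args →
          (args.map (operandVarSet (gateVarSets gs))).Pairwise Disjoint := by
        intro args hg
        have h := hsm gs.length args (by rw [hg]; simp)
        rwa [List.take_left'] at h
        rfl
      cases g with
      | sum args =>
        refine ⟨?_, fun x => ?_⟩
        · simp only [Gate.eval]
          apply Subalgebra.list_sum_mem
          intro f hf
          obtain ⟨a, ha, rfl⟩ := List.mem_map.1 hf
          exact Subalgebra.smul_mem _ (hop' a.2 (List.mem_map.2 ⟨a, ha, rfl⟩)) a.1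
        · simp only [Gate.eval]
          apply degreeOf_list_sum_le_one
          intro p hp
          obtain ⟨a, -, rfl⟩ := List.mem_map.1 hp
          rw [smul_eq_C_mul]
          exact (degreeOf_C_mul_le _ _ _).trans ((hop a.2).2 x)
      | prod args =>
        refine ⟨?_, fun x => ?_⟩
        · simp only [Gate.eval]
          apply Subalgebra.list_prod_mem
          intro f hf
          obtain ⟨u, hu, rfl⟩ := List.mem_map.1 hf
          exact hop' u hu
        · simp only [Gate.eval]
          exact degreeOf_prod_le_one (gateValues gs) (gateVarSets gs) hop x args (hpw args rfl)
    · -- a junk index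
      have e1 : (gateValues gs ++ [g.eval (gateValues gs)]).getD j 0 = 0 :=
        List.getD_eq_default _ _ (by rw [List.length_append, hlv, List.length_singleton]; omega)
      have e2 : (gateVarSets gs ++ [gateVarSet (gateVarSets gs) g]).getD j ∅ = ∅ :=
        List.getD_eq_default _ _ (by rw [List.length_append, hls, List.length_singleton]; omega)
      rw [e1, e2]
      exact ⟨Subalgebra.zero_mem _, fun x => by simp [degreeOf_zero]⟩

/-- **A syntactically multilinear circuit computes a multilinear polynomial.**
[cite: RazYehudayoff2008, §2] -/
theorem degreeOf_eval_le_one {P : ArithCircuit k σ}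
    (hsm : Literature.Computability.AlgebraicComplexity.IsSyntacticallyMultilinear P) (x : σ) :
    P.eval.degreeOf x ≤ 1 := by
  have hsm' := (isSyntacticallyMultilinear_iff_algebraicComplexity P).2 hsm
  unfold ArithCircuit.eval
  cases hP : P.output with
  | var i => exact degreeOf_X_le_one x i
  | const c => simp [Operand.eval, degreeOf_C]
  | gate j => exact (sm_getD_gateValues P.gates hsm' j).2 x

end Values

/-- A multilinear polynomial has total degree at most the number of variables. [folklore] -/
theorem totalDegree_le_card_of_degreeOf_le_one [CommSemiring k] [Fintype σ]
    {f : MvPolynomial σ k} (h : ∀ x, f.degreeOf x ≤ 1) : f.totalDegree ≤ Fintype.card σ := by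
  rw [totalDegree]
  refine Finset.sup_le fun m hm => ?_
  have hmx : ∀ x, m x ≤ 1 := fun x => (degreeOf_le_iff.1 (h x)) m hm
  calc m.sum (fun _ e => e) = ∑ x ∈ m.support, m x := rfl
    _ ≤ ∑ x ∈ m.support, 1 := Finset.sum_le_sum fun x _ => hmx x
    _ = m.support.card := by simp
    _ ≤ Fintype.card σ := Finset.card_le_univ _

/-! ### From `smCircuitSize` to `complexity` and degree -/

section Size

variable [CommSemiring k] [DecidableEq σ]

/-- A finite bound on `smCircuitSize f` is witnessed by a fan-in-two syntactically multilinear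
circuit computing `f` of at most that size. [cite: RazYehudayoff2008, §2] -/
theorem exists_circuit_of_smCircuitSize_le {f : MvPolynomial σ k} {s : ℕ}
    (h : Literature.Computability.AlgebraicComplexity.smCircuitSize f ≤ (s : ℕ∞)) :
    ∃ P : ArithCircuit k σ, P.IsFanInTwo ∧
      Literature.Computability.AlgebraicComplexity.IsSyntacticallyMultilinear P ∧ P.Computes f ∧
      P.size ≤ s := by
  by_contra hne
  push Not at hne
  have hle : ((s + 1 : ℕ) : ℕ∞) ≤ Literature.Computability.AlgebraicComplexity.smCircuitSize f := by
    unfold Literature.Computability.AlgebraicComplexity.smCircuitSize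
    refine le_iInf₂ fun P hP => ?_
    exact_mod_cast hne P hP.1 hP.2.1 hP.2.2
  have := hle.trans h
  norm_cast at this
  omega

/-- `complexity f ≤ smCircuitSize f` (for finite bounds): a syntactically multilinear fan-in-two
circuit is in particular a fan-in-two circuit. [cite: Burgisser2000, Def. 2.1] -/
theorem complexity_le_of_smCircuitSize_le {f : MvPolynomial σ k} {s : ℕ}
    (h : Literature.Computability.AlgebraicComplexity.smCircuitSize f ≤ (s : ℕ∞)) :
    complexity f ≤ s := by
  obtain ⟨P, h2, -, hc, hs⟩ := exists_circuit_of_smCircuitSize_le h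
  have hmem : P.size ∈ {s | ∃ Q : ArithCircuit k σ, Q.IsFanInTwo ∧ Q.Computes f ∧ Q.size = s} :=
    ⟨P, h2, hc, rfl⟩
  exact (Nat.sInf_le hmem).trans hs

/-- A polynomial of finite syntactically multilinear size is multilinear, so its total degree is
at most the number of variables. [cite: RazYehudayoff2008, §2] -/
theorem totalDegree_le_of_smCircuitSize_le [Fintype σ] {f : MvPolynomial σ k} {s : ℕ}
    (h : Literature.Computability.AlgebraicComplexity.smCircuitSize f ≤ (s : ℕ∞)) :
    f.totalDegree ≤ Fintype.card σ := by
  obtain ⟨P, -, hsm, hc, -⟩ := exists_circuit_of_smCircuitSize_le h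
  rw [← hc]
  exact totalDegree_le_card_of_degreeOf_le_one (degreeOf_eval_le_one hsm)

end Size

end MultilinearRung

end Summit.ValiantsHypothesis.ValiantsHypothesis.Theorems

end
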